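import Summits.Ventures.CertifiedManyBodySolver.Downfold.EmeryAxialSlabHg1201P10Windows
import Summits.Ventures.CertifiedManyBodySolver.Downfold.EmeryFermiFillingHg1201
import Summits.Ventures.CertifiedManyBodySolver.Downfold.EmeryFermiFillingLa214
import Summits.Ventures.CertifiedManyBodySolver.Downfold.EmeryAxialConductionBand
import HarnessLib

/-!
# HgBa₂CuO₄ at P = 10 GPa (box #19 §P-INTERVALS column): the axial co-shift census ON THE TYPED BOX `emeryBoxHg1201P10` — verdicts against the object-E row
# `t′/t ∈ [-0.57, -0.46]` and their FOUR-ORBITAL reading (companion of `EmeryAxialSlabHg1201P10Windows`, which carries the method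
# docstring, the slab table and the raw slab windows; the kernel certificates are in `EmeryAxialSlabHg1201P10Subs*`)

Venture CertifiedManyBodySolver, cell `pub/hubbard-downfold` (stage S1), seat hubbard-downfold-mod-4 (technique B); namespace
`Summit.Ventures.CertifiedManyBodySolver.Downfold.Emery`. Everything PROVED. READING (certified): `a ∈ [0, 0.4]` ⇒ the co-shifted Fermi surface is STILL LESS cuprate-like than the E row (`t′/t > -0.46`): the REQUIRED axial admixture at the Fermi level is `a_F > 0.4` eV (`emeryBoxHg1201P10_axial_short`).
WHAT THIS IS NOT: not a statement that the material's parameters ARE in the box (SCREENING-GRADE provenance); `U = 0` band kinematics; no phase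
sentence; the E row is a [float] literature refit; `a_F` is the ADDITIONAL admixture beyond the box's σ rows (a model-form distance).
Sources: [AndersenEtAl1995, §§5–6]; [PavariniEtAl2001, Eqs. (1)–(3), Fig. 3]; [HybertsenSchluterChristensen1989, Eq. (1)].
-/

noncomputable section

namespace Summit.Ventures.CertifiedManyBodySolver.Downfold.Emery

open Real Set
open Summit.Ventures.CertifiedManyBodySolver.Downfold

/-! ## §2 The typed box and the co-shift as a parameter -/

/-- The one-body rows and the per-spin filling of `emeryBoxHg1201P10` read by this file. [folklore] -/
theorem emeryBoxHg1201P10_axRows {p : EmeryCoord → ℝ} (hp : emeryBoxHg1201P10.Mem p) :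
    p .DeltaPd ∈ Set.Icc (23 / 20 : ℝ) (5 / 2 : ℝ) ∧ p .tpd ∈ Set.Icc (139 / 100 : ℝ) (77 / 50 : ℝ) ∧
      p .tpp ∈ Set.Icc (17 / 25 : ℝ) (79 / 100 : ℝ) ∧ p .tppP ∈ Set.Icc (289 / 2500 : ℝ) (289 / 2500 : ℝ) ∧
      (2 - p .nHoles) / 2 ∈ Set.Icc (21 / 50 : ℝ) (7 / 16 : ℝ) := by
  obtain ⟨h1, h2, h3, h4, h5, h6, h7, h8, -, -, -, -, -, -, hn1, hn2⟩ := (emeryBoxHg1201P10_mem_iff p).1 hp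
  push_cast at h1 h2 h3 h4 h5 h6 h7 h8 hn1 hn2
  exact ⟨⟨h1, h2⟩, ⟨h3, h4⟩, ⟨h5, h6⟩, ⟨h7, h8⟩, (abFilling_row_of_nHoles hn1 hn2 rfl)⟩

/-- **Slab 0 on the typed box**: for every parameter vector of `emeryBoxHg1201P10`, every co-shift `a ∈ [0, 0.15]` and every Fermi energy at
which the CO-SHIFTED σ antibonding band holds the box's electrons: `ε ∈ [1.44, 2.9]`, `t′/t ∈ [-0.3762, -0.2412]` (SHORT).
[folklore] -/
theorem emeryBoxHg1201P10_axSlab0 :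
    HoldsOn (fun p : EmeryCoord → ℝ => ∀ a ε : ℝ, a ∈ Set.Icc (0 : ℝ) (3 / 20 : ℝ) →
      abFilling (p .DeltaPd) (p .tpd) (p .tpp + a) (p .tppP + a) ε = (2 - p .nHoles) / 2 →
      ε ∈ Set.Icc (36 / 25 : ℝ) (29 / 10 : ℝ) ∧
      fsRatio (p .DeltaPd) (p .tpd) (p .tpp + a) (p .tppP + a) ε ∈ Set.Icc (-(1881 / 5000 : ℝ)) (-(603 / 2500 : ℝ))) emeryBoxHg1201P10 := by
  intro p hp a ε ha' hf
  obtain ⟨hΔ, ha, hb, hc, hν⟩ := emeryBoxHg1201P10_axRows hp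
  rw [← hf] at hν
  exact hg1201p10AxSlab0_window hΔ ha ⟨by linarith [hb.1, ha'.1], by linarith [hb.2, ha'.2]⟩
    ⟨by linarith [hc.1, ha'.1], by linarith [hc.2, ha'.2]⟩ hν

/-- **Slab 1 on the typed box**: for every parameter vector of `emeryBoxHg1201P10`, every co-shift `a ∈ [0.15, 0.3]` and every Fermi energy at
which the CO-SHIFTED σ antibonding band holds the box's electrons: `ε ∈ [1.38, 2.8]`, `t′/t ∈ [-0.4267, -0.3021]` (SHORT).
[folklore] -/
theorem emeryBoxHg1201P10_axSlab1 :
    HoldsOn (fun p : EmeryCoord → ℝ => ∀ a ε : ℝ, a ∈ Set.Icc (3 / 20 : ℝ) (3 / 10 : ℝ) →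
      abFilling (p .DeltaPd) (p .tpd) (p .tpp + a) (p .tppP + a) ε = (2 - p .nHoles) / 2 →
      ε ∈ Set.Icc (69 / 50 : ℝ) (14 / 5 : ℝ) ∧
      fsRatio (p .DeltaPd) (p .tpd) (p .tpp + a) (p .tppP + a) ε ∈ Set.Icc (-(4267 / 10000 : ℝ)) (-(3021 / 10000 : ℝ))) emeryBoxHg1201P10 := by
  intro p hp a ε ha' hf
  obtain ⟨hΔ, ha, hb, hc, hν⟩ := emeryBoxHg1201P10_axRows hp
  rw [← hf] at hν
  exact hg1201p10AxSlab1_window hΔ ha ⟨by linarith [hb.1, ha'.1], by linarith [hb.2, ha'.2]⟩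
    ⟨by linarith [hc.1, ha'.1], by linarith [hc.2, ha'.2]⟩ hν

/-- **Slab 2 on the typed box**: for every parameter vector of `emeryBoxHg1201P10`, every co-shift `a ∈ [0.3, 0.35]` and every Fermi energy at
which the CO-SHIFTED σ antibonding band holds the box's electrons: `ε ∈ [1.4, 2.66]`, `t′/t ∈ [-0.4375, -0.3429]` (SHORT).
[folklore] -/
theorem emeryBoxHg1201P10_axSlab2 :
    HoldsOn (fun p : EmeryCoord → ℝ => ∀ a ε : ℝ, a ∈ Set.Icc (3 / 10 : ℝ) (7 / 20 : ℝ) →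
      abFilling (p .DeltaPd) (p .tpd) (p .tpp + a) (p .tppP + a) ε = (2 - p .nHoles) / 2 →
      ε ∈ Set.Icc (7 / 5 : ℝ) (133 / 50 : ℝ) ∧
      fsRatio (p .DeltaPd) (p .tpd) (p .tpp + a) (p .tppP + a) ε ∈ Set.Icc (-(7 / 16 : ℝ)) (-(3429 / 10000 : ℝ))) emeryBoxHg1201P10 := by
  intro p hp a ε ha' hf
  obtain ⟨hΔ, ha, hb, hc, hν⟩ := emeryBoxHg1201P10_axRows hp
  rw [← hf] at hν
  exact hg1201p10AxSlab2_window hΔ ha ⟨by linarith [hb.1, ha'.1], by linarith [hb.2, ha'.2]⟩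
    ⟨by linarith [hc.1, ha'.1], by linarith [hc.2, ha'.2]⟩ hν

/-- **Slab 3 on the typed box**: for every parameter vector of `emeryBoxHg1201P10`, every co-shift `a ∈ [0.35, 0.4]` and every Fermi energy at
which the CO-SHIFTED σ antibonding band holds the box's electrons: `ε ∈ [1.38, 2.62]`, `t′/t ∈ [-0.4496, -0.3541]` (SHORT).
[folklore] -/
theorem emeryBoxHg1201P10_axSlab3 :
    HoldsOn (fun p : EmeryCoord → ℝ => ∀ a ε : ℝ, a ∈ Set.Icc (7 / 20 : ℝ) (2 / 5 : ℝ) →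
      abFilling (p .DeltaPd) (p .tpd) (p .tpp + a) (p .tppP + a) ε = (2 - p .nHoles) / 2 →
      ε ∈ Set.Icc (69 / 50 : ℝ) (131 / 50 : ℝ) ∧
      fsRatio (p .DeltaPd) (p .tpd) (p .tpp + a) (p .tppP + a) ε ∈ Set.Icc (-(281 / 625 : ℝ)) (-(3541 / 10000 : ℝ))) emeryBoxHg1201P10 := by
  intro p hp a ε ha' hf
  obtain ⟨hΔ, ha, hb, hc, hν⟩ := emeryBoxHg1201P10_axRows hp
  rw [← hf] at hν
  exact hg1201p10AxSlab3_window hΔ ha ⟨by linarith [hb.1, ha'.1], by linarith [hb.2, ha'.2]⟩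
    ⟨by linarith [hc.1, ha'.1], by linarith [hc.2, ha'.2]⟩ hν

/-- **Slab 4 on the typed box**: for every parameter vector of `emeryBoxHg1201P10`, every co-shift `a ∈ [0.4, 0.45]` and every Fermi energy at
which the CO-SHIFTED σ antibonding band holds the box's electrons: `ε ∈ [1.36, 2.62]`, `t′/t ∈ [-0.4621, -0.3645]` (MEETS).
[folklore] -/
theorem emeryBoxHg1201P10_axSlab4 :
    HoldsOn (fun p : EmeryCoord → ℝ => ∀ a ε : ℝ, a ∈ Set.Icc (2 / 5 : ℝ) (9 / 20 : ℝ) →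
      abFilling (p .DeltaPd) (p .tpd) (p .tpp + a) (p .tppP + a) ε = (2 - p .nHoles) / 2 →
      ε ∈ Set.Icc (34 / 25 : ℝ) (131 / 50 : ℝ) ∧
      fsRatio (p .DeltaPd) (p .tpd) (p .tpp + a) (p .tppP + a) ε ∈ Set.Icc (-(4621 / 10000 : ℝ)) (-(729 / 2000 : ℝ))) emeryBoxHg1201P10 := by
  intro p hp a ε ha' hf
  obtain ⟨hΔ, ha, hb, hc, hν⟩ := emeryBoxHg1201P10_axRows hp
  rw [← hf] at hν
  exact hg1201p10AxSlab4_window hΔ ha ⟨by linarith [hb.1, ha'.1], by linarith [hb.2, ha'.2]⟩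
    ⟨by linarith [hc.1, ha'.1], by linarith [hc.2, ha'.2]⟩ hν

/-- **Slab 5 on the typed box**: for every parameter vector of `emeryBoxHg1201P10`, every co-shift `a ∈ [0.45, 0.5]` and every Fermi energy at
which the CO-SHIFTED σ antibonding band holds the box's electrons: `ε ∈ [1.34, 2.58]`, `t′/t ∈ [-0.4722, -0.374]` (MEETS).
[folklore] -/
theorem emeryBoxHg1201P10_axSlab5 :
    HoldsOn (fun p : EmeryCoord → ℝ => ∀ a ε : ℝ, a ∈ Set.Icc (9 / 20 : ℝ) (1 / 2 : ℝ) →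
      abFilling (p .DeltaPd) (p .tpd) (p .tpp + a) (p .tppP + a) ε = (2 - p .nHoles) / 2 →
      ε ∈ Set.Icc (67 / 50 : ℝ) (129 / 50 : ℝ) ∧
      fsRatio (p .DeltaPd) (p .tpd) (p .tpp + a) (p .tppP + a) ε ∈ Set.Icc (-(2361 / 5000 : ℝ)) (-(187 / 500 : ℝ))) emeryBoxHg1201P10 := by
  intro p hp a ε ha' hf
  obtain ⟨hΔ, ha, hb, hc, hν⟩ := emeryBoxHg1201P10_axRows hp
  rw [← hf] at hν
  exact hg1201p10AxSlab5_window hΔ ha ⟨by linarith [hb.1, ha'.1], by linarith [hb.2, ha'.2]⟩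
    ⟨by linarith [hc.1, ha'.1], by linarith [hc.2, ha'.2]⟩ hν

/-- **Slab 6 on the typed box**: for every parameter vector of `emeryBoxHg1201P10`, every co-shift `a ∈ [0.5, 0.6]` and every Fermi energy at
which the CO-SHIFTED σ antibonding band holds the box's electrons: `ε ∈ [1.3, 2.6]`, `t′/t ∈ [-0.4945, -0.3822]` (MEETS).
[folklore] -/
theorem emeryBoxHg1201P10_axSlab6 :
    HoldsOn (fun p : EmeryCoord → ℝ => ∀ a ε : ℝ, a ∈ Set.Icc (1 / 2 : ℝ) (3 / 5 : ℝ) →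
      abFilling (p .DeltaPd) (p .tpd) (p .tpp + a) (p .tppP + a) ε = (2 - p .nHoles) / 2 →
      ε ∈ Set.Icc (13 / 10 : ℝ) (13 / 5 : ℝ) ∧
      fsRatio (p .DeltaPd) (p .tpd) (p .tpp + a) (p .tppP + a) ε ∈ Set.Icc (-(989 / 2000 : ℝ)) (-(1911 / 5000 : ℝ))) emeryBoxHg1201P10 := by
  intro p hp a ε ha' hf
  obtain ⟨hΔ, ha, hb, hc, hν⟩ := emeryBoxHg1201P10_axRows hp
  rw [← hf] at hν
  exact hg1201p10AxSlab6_window hΔ ha ⟨by linarith [hb.1, ha'.1], by linarith [hb.2, ha'.2]⟩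
    ⟨by linarith [hc.1, ha'.1], by linarith [hc.2, ha'.2]⟩ hν

/-! ## §3 The census verdicts against the E row -/

/-- **STILL SHORT OF THE E ROW for every co-shift `a ∈ [0, 0.4]`**: the co-shifted σ (= four-orbital at the Fermi level) `t′/t` stays ABOVE
`-0.46` — the one-band Fermi surface of record REQUIRES an axial admixture `a_F > 0.4` eV beyond the box's σ rows. [folklore] -/
theorem emeryBoxHg1201P10_axial_short :
    HoldsOn (fun p : EmeryCoord → ℝ => ∀ a ε : ℝ, a ∈ Set.Icc (0 : ℝ) (2 / 5 : ℝ) →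
      abFilling (p .DeltaPd) (p .tpd) (p .tpp + a) (p .tppP + a) ε = (2 - p .nHoles) / 2 →
      (-(23 / 50 : ℝ)) < fsRatio (p .DeltaPd) (p .tpd) (p .tpp + a) (p .tppP + a) ε) emeryBoxHg1201P10 := by
  intro p hp a ε ha' hf
  rcases mem_Icc_split ha' (3 / 10 : ℝ) with ha' | ha'
  · rcases mem_Icc_split ha' (3 / 20 : ℝ) with ha' | ha'
    · have h := (emeryBoxHg1201P10_axSlab0 p hp a ε ha' hf).2
      exact lt_of_lt_of_le (by norm_num) h.1
    · have h := (emeryBoxHg1201P10_axSlab1 p hp a ε ha' hf).2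
      exact lt_of_lt_of_le (by norm_num) h.1
  · rcases mem_Icc_split ha' (7 / 20 : ℝ) with ha' | ha'
    · have h := (emeryBoxHg1201P10_axSlab2 p hp a ε ha' hf).2
      exact lt_of_lt_of_le (by norm_num) h.1
    · have h := (emeryBoxHg1201P10_axSlab3 p hp a ε ha' hf).2
      exact lt_of_lt_of_le (by norm_num) h.1

/-! ## §4 The four-orbital reading (transfer theorem `EmeryAxialConductionBand.condFilling_eq_abFilling`) -/

/-- **FOUR-ORBITAL FORM OF THE SHORTFALL.** For every parameter vector of `emeryBoxHg1201P10`, EVERY axial level `ε_s` and coupling `t_sp`, and every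
Fermi energy `ε < ε_s` at which the four-orbital CONDUCTION band (`EmeryBandEigenvalues.band4 … 1`) holds the box's electrons: if the axial admixture
at the Fermi level `t_sp²/(ε_s − ε)` is at most `0.4` eV, the conduction-band Fermi surface (an exact `t–t′` contour,
`EmeryAxialConductionBand.oneBand_of_band4_one_eq`) has `t′/t > -0.46` — it does NOT reproduce the object-E row. [cite: PavariniEtAl2001, Eqs. (1)–(3), Fig. 3] -/
theorem emeryBoxHg1201P10_fourOrbital_short :
    HoldsOn (fun p : EmeryCoord → ℝ => ∀ εs tsp ε : ℝ, ε < εs →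
      tsp ^ 2 / (εs - ε) ≤ (2 / 5 : ℝ) →
      condFilling (p .DeltaPd) εs (p .tpd) (p .tpp) (p .tppP) tsp ε = (2 - p .nHoles) / 2 →
      (-(23 / 50 : ℝ)) < fsRatio (p .DeltaPd) (p .tpd) (p .tpp + tsp ^ 2 / (εs - ε)) (p .tppP + tsp ^ 2 / (εs - ε)) ε) emeryBoxHg1201P10 := by
  intro p hp εs tsp ε hε ha hf
  rw [condFilling_eq_abFilling hε] at hf
  exact emeryBoxHg1201P10_axial_short p hp _ ε ⟨div_nonneg (sq_nonneg _) (sub_pos.mpr hε).le, ha⟩ hf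

end Summit.Ventures.CertifiedManyBodySolver.Downfold.Emery
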